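import Literature.Analysis.FluidPDE.LerayHopfRegularRestartTools
import Literature.Analysis.FluidPDE.LerayHopfAssociatedPressure
import Literature.Analysis.FluidPDE.LerayHopfSpatialGradient
import Literature.Analysis.FluidPDE.LocalEnergySolutionsOn
import Literature.Analysis.FluidPDE.LocalEnergyTimeShift
import Literature.Analysis.FluidPDE.NSBoundedSuitableEnergy
import Literature.Analysis.FluidPDE.SuitableWeakExhaustion
import Literature.Analysis.FluidPDE.NSSereginLimitDecay
import Literature.Analysis.FluidPDE.LocalLerayExistence
import HarnessLib

/-!
# Restarting a Leray–Hopf solution, regular before its first blow-up time, as a local energy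
# solution

Analysis/FluidPDE proof file (theorems only, no new definitions or facts). It **discharges the
hypothesis `hLE`** of `BarkerPrange2020_thm2_of_localizedSmoothing`
(`BarkerPrangeConcentrationProofs.lean`; Barker–Prange 2020, §4.2: Theorem 1, a statement about
local energy solutions, is applied to the rescaled Leray–Hopf solution `u_λ` — "`u_λ` … with
initial data `u_λ(·, 0)`" — which is legitimate because `u` is regular on the open strip before
its first blow-up time):

> **Theorem** (`IsGlobalLerayHopf.exists_isLocalEnergySolutionOn_restart`). Let `u` be a global
> Leray–Hopf weak solution of the unforced Navier–Stokes equations with viscosity `ν > 0` on `ℝ³`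
> (`IsGlobalLerayHopf ν 0 u₀ u`), and let every point `(t, x)` of the open strip `0 < t < T` be a
> regular point of `u`. Then for every `t₀ ∈ (0, T)` there is a pressure `π` such that
> `(s ↦ u(t₀ + s), π)` is a local energy solution on `ℝ³ × (0, T - t₀)` with datum `u(t₀)` in
> the sense of Seregin 2014, Def. B.1 / Kang–Miura–Tsai 2021, Def. 3.1
> (`IsLocalEnergySolutionOn (T - t₀) ν (u t₀) (fun s => u (t₀ + s)) π`).

The pressure is the associated pressure of the Leray–Hopf solution
(`IsLerayHopfOn.exists_associated_pressure`: `p ∈ L^{3/2}((0, T) × ℝ³)`, `(u, p)` distributional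
on the strip), translated in time. The clauses of Def. B.1: (B.1.5)+(B.1.8) — on every bounded box
compactly inside the strip `u` is essentially bounded (regular points, finite subcover:
`exists_isOpen_ae_bound_of_forall_isRegularPoint`), so `(u, p)` is suitable there
(`isSuitableWeakSolutionOn_of_bounded`, Seregin–Šverák 2009 §2 / Serrin), and suitability glues
along an exhaustion of the strip `(t₀, T) × ℝ³` (`IsSuitableWeakSolutionOn.of_exhaustion`) and
translates in time (`IsSuitableWeakSolutionOn.timeShift`); (B.1.4) — the every-time energy bound
`‖u(t)‖₂² ≤ ‖u₀‖₂²` and the finite dissipation of the Leray–Hopf class (weak spatial gradient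
`IsLerayHopfOn.exists_hasWeakSpatialGradientOn`), and `p ∈ L^{3/2}` of the strip; (B.1.6) — weak
continuity on `[t₀, T] ⊆ (0, T]` is part of the Leray–Hopf class; (B.1.7) — **the datum is
attained in `L²_loc` at the regular time `t₀`**: near each `(t₀, x)` the solution has a
continuous representative (`exists_box_continuousOn_ae_eq_of_isRegularPoint`, from the tree's
`NSBoundedInteriorContinuity_holds`), every slice of the weakly continuous `u` coincides with it
(`ae_eq_slice_of_weaklyContinuous_of_continuousOn`), whence `∫_{B̄} |u(t₀ + s) - u(t₀)|² → 0`
(`tendsto_lintegral_closedBall_sub_sq_of_continuousOn`), and a compact set is covered by finitely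
many such balls; the decay at spatial infinity — slices in `L²` decay
(`tendsto_setLIntegral_ball_cocompact`) and `tendsto_lintegral_prod_ball_cocompact_of_slices`.

## References

* T. Barker, C. Prange, Arch. Ration. Mech. Anal. 236 (2020) = arXiv:1812.09115, §4.2 and
  Def. 16. [BarkerPrange2020]
* G. Seregin, *Lecture Notes on Regularity Theory for the Navier–Stokes Equations* (2014),
  App. B, Def. B.1, Remark B.4 (restarting needs `L²_loc`-continuity at `t₀`). [Seregin2014]
* L. Caffarelli, R. Kohn, L. Nirenberg, Comm. Pure Appl. Math. 35 (1982), §6. [CaffarelliKohnNirenberg1982]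
* G. Seregin, V. Šverák, Comm. PDE 34 (2009) = arXiv:0804.1803, §2 pp. 6–8. [SereginSverak2009]
-/

noncomputable section

open MeasureTheory TopologicalSpace Set Function Filter Metric
open _root_.Topology
open scoped ENNReal NNReal RealInnerProductSpace

namespace Literature.Analysis.FluidPDE

/-! ### An exhaustion of the strip `(t₀, T) × ℝ³` by bounded boxes compactly inside `(0, T) × ℝ³` -/

/-- The boxes `Qₙ = (t₀ + c/(n+2), T - c/(n+2)) × B(0, n+1)`, `c = (T - t₀)/2`. [folklore] -/
theorem exists_box_exhaustion {t₀ T : ℝ} (ht₀ : 0 < t₀) (hT : t₀ < T) :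
    ∃ Qn : ℕ → Opens (ℝ × EuclideanSpace ℝ (Fin 3)),
      (∀ n, Qn n ≤ slab (EuclideanSpace ℝ (Fin 3)) (Ioo t₀ T) isOpen_Ioo) ∧ Monotone Qn ∧
      (∀ K ⊆ ((slab (EuclideanSpace ℝ (Fin 3)) (Ioo t₀ T) isOpen_Ioo :
          Opens (ℝ × EuclideanSpace ℝ (Fin 3))) : Set (ℝ × EuclideanSpace ℝ (Fin 3))),
        IsCompact K → ∃ n, K ⊆ (Qn n : Set (ℝ × EuclideanSpace ℝ (Fin 3)))) ∧
      ∀ n, ∃ a b R : ℝ, 0 < a ∧ b < T ∧ a < b ∧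
        ((Qn n : Opens (ℝ × EuclideanSpace ℝ (Fin 3))) : Set (ℝ × EuclideanSpace ℝ (Fin 3))) =
          Ioo a b ×ˢ ball (0 : EuclideanSpace ℝ (Fin 3)) R := by
  set c : ℝ := (T - t₀) / 2 with hc
  have hcpos : 0 < c := by rw [hc]; linarith
  set Qn : ℕ → Opens (ℝ × EuclideanSpace ℝ (Fin 3)) := fun n =>
    ⟨Ioo (t₀ + c / (n + 2)) (T - c / (n + 2)) ×ˢ ball (0 : EuclideanSpace ℝ (Fin 3)) (n + 1),
      isOpen_Ioo.prod isOpen_ball⟩ with hQn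
  have hcoe : ∀ n, ((Qn n : Opens (ℝ × EuclideanSpace ℝ (Fin 3))) : Set (ℝ × EuclideanSpace ℝ (Fin 3))) =
      Ioo (t₀ + c / (n + 2)) (T - c / (n + 2)) ×ˢ ball (0 : EuclideanSpace ℝ (Fin 3)) (n + 1) :=
    fun n => rfl
  have hcn : ∀ n : ℕ, 0 < c / (n + 2) := fun n => by positivity
  have hcn' : ∀ n : ℕ, c / (n + 2) ≤ c / 2 := fun n =>
    div_le_div_of_nonneg_left hcpos.le (by norm_num) (by linarith [n.cast_nonneg (α := ℝ)])
  refine ⟨Qn, fun n => ?_, ?_, ?_, fun n => ⟨t₀ + c / (n + 2), T - c / (n + 2), n + 1,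
    by linarith [hcn n], by linarith [hcn n], by
      have := hcn' n; rw [hc] at this ⊢; linarith, hcoe n⟩⟩
  · -- inside the strip
    intro z hz
    rw [mem_slab]
    have hz' : z ∈ Ioo (t₀ + c / (n + 2)) (T - c / (n + 2)) ×ˢ ball (0 : EuclideanSpace ℝ (Fin 3)) (n + 1) := hz
    exact ⟨by linarith [hz'.1.1, hcn n], by linarith [hz'.1.2, hcn n]⟩
  · -- monotone
    intro m n hmn z hz
    have hz' : z ∈ Ioo (t₀ + c / (m + 2)) (T - c / (m + 2)) ×ˢ ball (0 : EuclideanSpace ℝ (Fin 3)) (m + 1) := hz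
    have h1 : c / (n + 2) ≤ c / (m + 2) :=
      div_le_div_of_nonneg_left hcpos.le (by positivity) (by exact_mod_cast Nat.add_le_add_right hmn 2)
    have h2 : (m : ℝ) + 1 ≤ n + 1 := by exact_mod_cast Nat.add_le_add_right hmn 1
    change z ∈ Ioo (t₀ + c / (n + 2)) (T - c / (n + 2)) ×ˢ ball (0 : EuclideanSpace ℝ (Fin 3)) (n + 1)
    exact ⟨⟨by linarith [hz'.1.1], by linarith [hz'.1.2]⟩, ball_subset_ball h2 hz'.2⟩
  · -- compact subsets of the strip lie in one box: the boxes cover the strip and increase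
    intro K hK hKc
    have hcovU : K ⊆ ⋃ n, ((Qn n : Opens (ℝ × EuclideanSpace ℝ (Fin 3))) : Set (ℝ × EuclideanSpace ℝ (Fin 3))) := by
      intro z hz
      have hz' := mem_slab.1 (hK hz)
      set m : ℝ := min (z.1 - t₀) (T - z.1) with hm
      have hmpos : 0 < m := lt_min (by linarith [hz'.1]) (by linarith [hz'.2])
      obtain ⟨n, hn⟩ := exists_nat_gt (max (c / m) ‖z.2‖)
      have hn1 : c / m < n := (le_max_left _ _).trans_lt hn
      have hn2 : ‖z.2‖ < n := (le_max_right _ _).trans_lt hn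
      refine mem_iUnion.2 ⟨n, ?_⟩
      change z ∈ Ioo (t₀ + c / (n + 2)) (T - c / (n + 2)) ×ˢ ball (0 : EuclideanSpace ℝ (Fin 3)) (n + 1)
      have h3 : c / (n + 2) < m := by
        rw [div_lt_iff₀ (by positivity)]
        rw [div_lt_iff₀ hmpos] at hn1
        nlinarith
      have h4 : m ≤ z.1 - t₀ := min_le_left _ _
      have h5 : m ≤ T - z.1 := min_le_right _ _
      refine ⟨⟨by linarith, by linarith⟩, ?_⟩
      rw [mem_ball, dist_zero_right]
      linarith
    obtain ⟨t, ht⟩ := hKc.elim_finite_subcover _ (fun n => (Qn n).isOpen) hcovU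
    refine ⟨t.sup id, ht.trans (iUnion₂_subset fun n hn => ?_)⟩
    have hmono : Monotone Qn := by
      intro m n hmn z hz
      have hz' : z ∈ Ioo (t₀ + c / (m + 2)) (T - c / (m + 2)) ×ˢ ball (0 : EuclideanSpace ℝ (Fin 3)) (m + 1) := hz
      have h1 : c / (n + 2) ≤ c / (m + 2) :=
        div_le_div_of_nonneg_left hcpos.le (by positivity) (by exact_mod_cast Nat.add_le_add_right hmn 2)
      have h2 : (m : ℝ) + 1 ≤ n + 1 := by exact_mod_cast Nat.add_le_add_right hmn 1
      change z ∈ Ioo (t₀ + c / (n + 2)) (T - c / (n + 2)) ×ˢ ball (0 : EuclideanSpace ℝ (Fin 3)) (n + 1)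
      exact ⟨⟨by linarith [hz'.1.1], by linarith [hz'.1.2]⟩, ball_subset_ball h2 hz'.2⟩
    exact hmono (Finset.le_sup (f := id) hn)

/-! ### The restart theorem -/

/-- **Restarting a Leray–Hopf solution, regular on the open strip `(0, T)`, at a time
`t₀ ∈ (0, T)` as a local energy solution** (the step implicit in Barker–Prange 2020, §4.2, when
Theorem 1 is applied to `u_λ` with "initial data `u_λ(·, 0)`"; Seregin 2014, Def. B.1 and
Remark B.4). Let `u` be a global Leray–Hopf weak solution of the unforced Navier–Stokes equations
on `ℝ³` with viscosity `ν > 0`, all of whose points `(t, x)`, `0 < t < T`, are regular. Then for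
`t₀ ∈ (0, T)`, with `π(s) = p(t₀ + s)` the translated associated pressure
(`IsLerayHopfOn.exists_associated_pressure`), `(u(t₀ + ·), π)` is a local energy solution on
`ℝ³ × (0, T - t₀)` with datum `u(t₀)`: suitability from local essential boundedness
(`isSuitableWeakSolutionOn_of_bounded` on the boxes of `exists_box_exhaustion`,
`IsSuitableWeakSolutionOn.of_exhaustion`, `.timeShift`); the uniformly local bounds and the decay
from the energy inequality and the finite dissipation; weak continuity on `[t₀, T]` from the
Leray–Hopf class; the datum in `L²_loc` from the continuous representatives around the regular
points `(t₀, x)` (`exists_box_continuousOn_ae_eq_of_isRegularPoint`,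
`ae_eq_slice_of_weaklyContinuous_of_continuousOn`,
`tendsto_lintegral_closedBall_sub_sq_of_continuousOn`).
[cite: BarkerPrange2020, §4.2 (arXiv:1812.09115 p. 16) with Def. 16; Seregin2014 Def. B.1, Remark B.4] -/
theorem IsGlobalLerayHopf.exists_isLocalEnergySolutionOn_restart {ν : ℝ} (hν : 0 < ν)
    {u₀ : EuclideanSpace ℝ (Fin 3) → EuclideanSpace ℝ (Fin 3)}
    {u : ℝ → EuclideanSpace ℝ (Fin 3) → EuclideanSpace ℝ (Fin 3)}
    (hLH : IsGlobalLerayHopf ν 0 u₀ u) {T : ℝ} (hT : 0 < T)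
    (hreg : ∀ t ∈ Ioo 0 T, ∀ x : EuclideanSpace ℝ (Fin 3), IsRegularPoint u (t, x))
    {t₀ : ℝ} (ht₀ : t₀ ∈ Ioo 0 T) :
    ∃ π : ℝ → EuclideanSpace ℝ (Fin 3) → ℝ,
      IsLocalEnergySolutionOn (T - t₀) ν (u t₀) (fun s => u (t₀ + s)) π := by
  have hLHT : IsLerayHopfOn T ν 0 u₀ u := hLH T hT
  -- the associated pressure on the strip `(0, T) × ℝ³`
  obtain ⟨p, hp32, hNS, -⟩ := hLHT.exists_associated_pressure hT
  have htoReal : ((3 / 2 : ℝ≥0∞)).toReal = (3 / 2 : ℝ) := by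
    rw [ENNReal.toReal_div, ENNReal.toReal_ofNat, ENNReal.toReal_ofNat]
  have hpslab : ∫⁻ z in Ioo 0 T ×ˢ (univ : Set (EuclideanSpace ℝ (Fin 3))),
      ‖p z.1 z.2‖ₑ ^ (3 / 2 : ℝ) < ∞ := by
    have h := lintegral_rpow_enorm_lt_top_of_eLpNorm_lt_top (by norm_num)
      (ENNReal.div_ne_top (by norm_num) (by norm_num)) hp32.eLpNorm_lt_top
    rw [htoReal] at h
    exact h
  have hpK : ∀ K ⊆ ((slab (EuclideanSpace ℝ (Fin 3)) (Ioo 0 T) isOpen_Ioo :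
      Opens (ℝ × EuclideanSpace ℝ (Fin 3))) : Set (ℝ × EuclideanSpace ℝ (Fin 3))),
      IsCompact K → ∫⁻ z in K, ‖p z.1 z.2‖ₑ ^ (3 / 2 : ℝ) < ∞ :=
    fun K hK _ => lt_of_le_of_lt (lintegral_mono_set hK) hpslab
  -- times of the restarted interval
  have hIcc : ∀ {s : ℝ}, s ∈ Icc 0 (T - t₀) → t₀ + s ∈ Icc 0 T := fun hs =>
    ⟨by linarith [hs.1, ht₀.1], by linarith [hs.2]⟩
  -- the every-time energy bound `∫ |u(t)|² ≤ 2 E(u₀)`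
  have henergy : ∀ t ∈ Icc 0 T, eEnergy (u t) ≤ ENNReal.ofReal (2 * VectorCalculus.kineticEnergy u₀) := by
    obtain ⟨G, -, -, hE, -⟩ := hLHT.weakGrad_energy
    intro t ht
    have hE' : VectorCalculus.kineticEnergy (u t) +
        ν * (∫⁻ τ in Ioo 0 t, ∫⁻ x, ENNReal.ofReal (frobeniusNormSq (G τ x))).toReal ≤
          VectorCalculus.kineticEnergy u₀ := by simpa using hE t ht
    have hD : 0 ≤ ν * (∫⁻ τ in Ioo 0 t, ∫⁻ x, ENNReal.ofReal (frobeniusNormSq (G τ x))).toReal :=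
      mul_nonneg hν.le ENNReal.toReal_nonneg
    rw [hLHT.eEnergy_eq ht]
    exact ENNReal.ofReal_le_ofReal (by linarith)
  -- weak continuity on the restarted closed interval
  have hwcI : ∀ w : EuclideanSpace ℝ (Fin 3) → EuclideanSpace ℝ (Fin 3), MemLp w 2 volume →
      ContinuousOn (fun t => ∫ y, ⟪u t y, w y⟫) (Ioc 0 T) := fun w hw => (hLHT.weak_continuous w hw).1
  refine ⟨fun s y => p (t₀ + s) y,
    { suitable := ?_
      pressure := ?_
      sliceMeasurable := ?_
      uniformLocalEnergy := ?_
      uniformLocalGradient := ?_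
      weakContinuous := ?_
      initial := ?_
      decay := ?_ }⟩
  · -- (B.1.5), (B.1.8): suitability on the strip `(t₀, T)`, glued from bounded boxes, translated
    obtain ⟨Qn, hle, hmono, hcov, hbox⟩ := exists_box_exhaustion ht₀.1 ht₀.2
    have hsuit : IsSuitableWeakSolutionOn (slab (EuclideanSpace ℝ (Fin 3)) (Ioo t₀ T) isOpen_Ioo) ν 0 u p := by
      refine IsSuitableWeakSolutionOn.of_exhaustion hle hmono hcov fun n => ?_
      obtain ⟨a, b, R, ha, hb, hab, hQ⟩ := hbox n
      have hleT : Qn n ≤ slab (EuclideanSpace ℝ (Fin 3)) (Ioo 0 T) isOpen_Ioo := by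
        intro z hz
        have hz' : z ∈ Ioo a b ×ˢ ball (0 : EuclideanSpace ℝ (Fin 3)) R := by
          rw [← hQ]; exact hz
        exact mem_slab.2 ⟨ha.trans hz'.1.1, hz'.1.2.trans hb⟩
      have hNSn : IsDistributionalNSSolutionOn (Qn n) ν 0 u p :=
        IsDistributionalNSSolutionOn.mono_holds hNS hleT
      have hvol : volume ((Qn n : Opens (ℝ × EuclideanSpace ℝ (Fin 3))) : Set (ℝ × EuclideanSpace ℝ (Fin 3))) < ∞ := by
        rw [hQ, Measure.volume_eq_prod, Measure.prod_prod]
        exact ENNReal.mul_lt_top (by rw [Real.volume_Ioo]; exact ENNReal.ofReal_lt_top) measure_ball_lt_top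
      -- essential boundedness on the box: its closure is a compact set of regular points
      have hKc : IsCompact (Icc a b ×ˢ closedBall (0 : EuclideanSpace ℝ (Fin 3)) R) :=
        isCompact_Icc.prod (isCompact_closedBall _ _)
      have hKreg : ∀ z ∈ Icc a b ×ˢ closedBall (0 : EuclideanSpace ℝ (Fin 3)) R, IsRegularPoint u z := by
        rintro ⟨s, y⟩ ⟨hs, -⟩
        exact hreg s ⟨ha.trans_le hs.1, hs.2.trans_lt hb⟩ y
      obtain ⟨U, -, hKU, M, hM⟩ := exists_isOpen_ae_bound_of_forall_isRegularPoint hKc hKreg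
      have hMn : ∀ᵐ z ∂(volume.restrict ((Qn n : Opens (ℝ × EuclideanSpace ℝ (Fin 3))) :
          Set (ℝ × EuclideanSpace ℝ (Fin 3)))), ‖u z.1 z.2‖ ≤ M := by
        rw [hQ]
        exact ae_restrict_of_ae_restrict_of_subset
          ((Set.prod_mono Ioo_subset_Icc_self ball_subset_closedBall).trans hKU) hM
      have hpn : ∫⁻ z in ((Qn n : Opens (ℝ × EuclideanSpace ℝ (Fin 3))) : Set (ℝ × EuclideanSpace ℝ (Fin 3))),
          ‖p z.1 z.2‖ₑ ^ (3 / 2 : ℝ) < ∞ :=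
        lt_of_le_of_lt (lintegral_mono_set hleT) hpslab
      exact isSuitableWeakSolutionOn_of_bounded hν hNSn hvol hMn hpn
    have h1 := hsuit.timeShift t₀
    rw [sub_self] at h1
    exact h1
  · -- (B.1.4): `π ∈ L^{3/2}((0, T - t₀) × K)`
    intro K hK
    have h1 := setLIntegral_prod_timeShift t₀ t₀ T K
      (fun z : ℝ × EuclideanSpace ℝ (Fin 3) => ‖p z.1 z.2‖ₑ ^ (3 / 2 : ℝ))
    rw [sub_self] at h1
    rw [h1]
    exact lt_of_le_of_lt (lintegral_mono_set (Set.prod_mono (Ioo_subset_Ioo ht₀.1.le le_rfl)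
      (subset_univ K))) hpslab
  · -- slices are measurable
    intro s hs
    exact (hLHT.memLp (t₀ + s) (hIcc hs)).1
  · -- (B.1.4): the every-time unit-ball bound
    refine ⟨(ENNReal.ofReal (2 * VectorCalculus.kineticEnergy u₀)).toNNReal, fun s hs x₁ => ?_⟩
    rw [ENNReal.coe_toNNReal ENNReal.ofReal_ne_top]
    exact (setLIntegral_le_lintegral _ _).trans (henergy (t₀ + s) (hIcc hs))
  · -- (B.1.4): the weak spatial gradient and its unit-box bound
    obtain ⟨G, hG, -, hGint, -⟩ := hLHT.exists_hasWeakSpatialGradientOn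
    have hG' : HasWeakSpatialGradientOn (slab (EuclideanSpace ℝ (Fin 3)) (Ioo t₀ T) isOpen_Ioo) u G :=
      hG.mono (slab_mono (Ioo_subset_Ioo ht₀.1.le le_rfl))
    have h1 := hG'.timeShift t₀
    rw [sub_self] at h1
    refine ⟨fun s y => G (t₀ + s) y, h1, ?_⟩
    refine ⟨(∫⁻ z in Ioo 0 T ×ˢ (univ : Set (EuclideanSpace ℝ (Fin 3))),
      ENNReal.ofReal (frobeniusNormSq (G z.1 z.2))).toNNReal, fun x₁ => ?_⟩
    rw [ENNReal.coe_toNNReal hGint.ne]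
    have h2 := setLIntegral_prod_timeShift t₀ t₀ T (ball x₁ 1)
      (fun z : ℝ × EuclideanSpace ℝ (Fin 3) => ENNReal.ofReal (frobeniusNormSq (G z.1 z.2)))
    rw [sub_self] at h2
    rw [h2]
    exact lintegral_mono_set (Set.prod_mono (Ioo_subset_Ioo ht₀.1.le le_rfl) (subset_univ _))
  · -- (B.1.6): weak continuity on `[0, T - t₀]`
    intro φ hφ
    have hφ2 : MemLp φ 2 volume :=
      hφ.contDiff.continuous.memLp_of_hasCompactSupport hφ.hasCompactSupport
    have hmaps : MapsTo (fun s : ℝ => t₀ + s) (Icc 0 (T - t₀)) (Ioc 0 T) := fun s hs =>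
      ⟨by linarith [hs.1, ht₀.1], by linarith [hs.2]⟩
    exact (hwcI φ hφ2).comp (continuous_const.add continuous_id).continuousOn hmaps
  · -- (B.1.7): the datum `u(t₀)` is attained in `L²_loc` — `t₀` is a regular time
    intro K hK
    -- around each `x`, a ball on which `∫ |u(t₀ + s) - u(t₀)|² → 0`
    have hball : ∀ x : EuclideanSpace ℝ (Fin 3), ∃ ρ : ℝ, 0 < ρ ∧
        Tendsto (fun s => ∫⁻ y in closedBall x ρ, ‖u (t₀ + s) y - u t₀ y‖ₑ ^ 2) (𝓝 0) (𝓝 0) := by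
      intro x
      have hz : ((t₀, x) : ℝ × EuclideanSpace ℝ (Fin 3)) ∈
          ((slab (EuclideanSpace ℝ (Fin 3)) (Ioo 0 T) isOpen_Ioo :
            Opens (ℝ × EuclideanSpace ℝ (Fin 3))) : Set (ℝ × EuclideanSpace ℝ (Fin 3))) :=
        mem_slab.2 ht₀
      obtain ⟨δ, hδ, R, hR, hsub, v, hvc, hvae⟩ :=
        exists_box_continuousOn_ae_eq_of_isRegularPoint hν hNS hpK hz (hreg t₀ ht₀ x)
      -- the time window lies in `(0, T)`
      have hIsub : Ioo (t₀ - δ) (t₀ + δ) ⊆ Ioo 0 T := fun s hs => by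
        have h := hsub (mk_mem_prod hs (mem_ball_self hR))
        exact mem_slab.1 h
      have hwc : ∀ w : EuclideanSpace ℝ (Fin 3) → EuclideanSpace ℝ (Fin 3), MemLp w 2 volume →
          ContinuousOn (fun t => ∫ y, ⟪u t y, w y⟫) (Ioo (t₀ - δ) (t₀ + δ)) := fun w hw =>
        (hwcI w hw).mono (hIsub.trans Ioo_subset_Ioc_self)
      have hloc : ∀ t ∈ Ioo (t₀ - δ) (t₀ + δ), LocallyIntegrable (u t) volume := fun t ht =>
        (hLHT.memLp t (Ioo_subset_Icc_self (hIsub ht))).locallyIntegrable (by norm_num)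
      have hid : ∀ τ ∈ Ioo (t₀ - δ) (t₀ + δ), ∀ᵐ y ∂(volume.restrict (ball x R)), u τ y = v (τ, y) :=
        fun τ hτ => ae_eq_slice_of_weaklyContinuous_of_continuousOn hwc hloc hvc hvae hτ
      have ht₀I : t₀ ∈ Ioo (t₀ - δ) (t₀ + δ) := ⟨by linarith, by linarith⟩
      exact ⟨R / 2, by positivity,
        tendsto_lintegral_closedBall_sub_sq_of_continuousOn hvc hid ht₀I (by linarith)⟩
    choose ρ hρ hlim using hball
    -- a finite subcover of `K` by the open balls
    obtain ⟨t, ht⟩ := hK.elim_finite_subcover (fun x => ball x (ρ x)) (fun _ => isOpen_ball)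
      fun x _ => mem_iUnion.2 ⟨x, mem_ball_self (hρ x)⟩
    have hKsub : K ⊆ ⋃ x ∈ t, closedBall x (ρ x) :=
      ht.trans (iUnion₂_mono fun x _ => ball_subset_closedBall)
    -- `∫_K ≤ Σ ∫_{B̄ᵢ}`, each tending to `0`
    have hlim2 : Tendsto (fun s => ∫⁻ y in K, ‖u (t₀ + s) y - u t₀ y‖ₑ ^ 2) (𝓝 0) (𝓝 0) := by
      refine ENNReal.tendsto_nhds_zero.2 fun ε hε => ?_
      have hev : ∀ x ∈ t, ∀ᶠ s in 𝓝 (0 : ℝ),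
          ∫⁻ y in closedBall x (ρ x), ‖u (t₀ + s) y - u t₀ y‖ₑ ^ 2 ≤ ε / t.card := fun x _ =>
        ENNReal.tendsto_nhds_zero.1 (hlim x) _ (by
          refine ENNReal.div_pos hε.ne' (ENNReal.natCast_ne_top _))
      filter_upwards [(t.eventually_all).2 hev] with s hs
      calc ∫⁻ y in K, ‖u (t₀ + s) y - u t₀ y‖ₑ ^ 2
          ≤ ∫⁻ y in ⋃ x ∈ t, closedBall x (ρ x), ‖u (t₀ + s) y - u t₀ y‖ₑ ^ 2 :=
            lintegral_mono_set hKsub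
        _ ≤ t.card * (ε / t.card) := lintegral_biUnion_finset_le_card_mul t _ _ hs
        _ ≤ ε := ENNReal.mul_div_le
    exact hlim2.mono_left nhdsWithin_le_nhds
  · -- decay at spatial infinity on the strip
    intro R hR
    -- measurability of the translated field on the strip `(0, T - t₀)`
    have hmeasT : AEStronglyMeasurable (uncurry u)
        (volume.restrict (Ioo 0 T ×ˢ (univ : Set (EuclideanSpace ℝ (Fin 3))))) := hLHT.weak.1
    have hq : Measure.QuasiMeasurePreserving (stAffine 1 1 t₀ (0 : EuclideanSpace ℝ (Fin 3)))
        (volume.restrict (Ioo 0 (T - t₀) ×ˢ (univ : Set (EuclideanSpace ℝ (Fin 3)))))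
        (volume.restrict (Ioo 0 T ×ˢ (univ : Set (EuclideanSpace ℝ (Fin 3))))) := by
      refine ⟨measurable_stAffine _ _ _ _, ?_⟩
      have hmap := map_stAffine_volume_restrict_preimage one_pos one_pos t₀
        (0 : EuclideanSpace ℝ (Fin 3)) (Ioo t₀ T ×ˢ (univ : Set (EuclideanSpace ℝ (Fin 3))))
      rw [stAffine_one_one_preimage_prod, sub_self] at hmap
      rw [hmap]
      exact Measure.smul_absolutelyContinuous.trans (Measure.absolutelyContinuous_of_le
        (Measure.restrict_mono (Set.prod_mono (Ioo_subset_Ioo ht₀.1.le le_rfl) Subset.rfl) le_rfl))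
    have hmeas : AEStronglyMeasurable (uncurry fun s => u (t₀ + s))
        (volume.restrict (Ioo 0 (T - t₀) ×ˢ (univ : Set (EuclideanSpace ℝ (Fin 3))))) := by
      have h1 := hmeasT.comp_quasiMeasurePreserving hq
      have e : uncurry u ∘ stAffine 1 1 t₀ (0 : EuclideanSpace ℝ (Fin 3)) =
          uncurry fun s => u (t₀ + s) := by
        funext z
        simp only [Function.comp_apply, stAffine, one_mul, one_smul, zero_add, uncurry]
      rw [e] at h1
      exact h1
    -- every-time unit-ball bound and slicewise decay
    have hC : ∀ s ∈ Ioo 0 (T - t₀), ∀ x₀ : EuclideanSpace ℝ (Fin 3),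
        ∫⁻ y in ball x₀ 1, ‖(fun s => u (t₀ + s)) s y‖ₑ ^ 2 ≤
          (ENNReal.ofReal (2 * VectorCalculus.kineticEnergy u₀)).toNNReal := by
      intro s hs x₀
      rw [ENNReal.coe_toNNReal ENNReal.ofReal_ne_top]
      exact (setLIntegral_le_lintegral _ _).trans (henergy (t₀ + s) (hIcc (Ioo_subset_Icc_self hs)))
    have hdec : ∀ᵐ s ∂(volume.restrict (Ioo (0 : ℝ) (T - t₀))),
        Tendsto (fun x₀ : EuclideanSpace ℝ (Fin 3) => ∫⁻ y in ball x₀ 1, ‖(fun s => u (t₀ + s)) s y‖ₑ ^ 2)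
          (cocompact (EuclideanSpace ℝ (Fin 3))) (𝓝 0) := by
      refine (ae_restrict_mem measurableSet_Ioo).mono fun s hs => ?_
      have hfin : ∫⁻ y, ‖u (t₀ + s) y‖ₑ ^ 2 ≠ ∞ :=
        ((henergy (t₀ + s) (hIcc (Ioo_subset_Icc_self hs))).trans_lt ENNReal.ofReal_lt_top).ne
      exact tendsto_setLIntegral_ball_cocompact hfin 1
    exact tendsto_lintegral_prod_ball_cocompact_of_slices hmeas hC hdec R

end Literature.Analysis.FluidPDE

end
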